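import Summits.HodgeConjecture.HodgeCM.Model.LiuIndexTwistTypeOfV
import Summits.HodgeConjecture.HodgeCM.Model.ArchKTypeOfCentralWeight_2
import Summits.HodgeConjecture.HodgeCM.Model.AdelicThetaDistributionBridgeTwist
import Summits.HodgeConjecture.HodgeCM.Model.ArchSideOfTwist
import HarnessLib

/-!
# FLOOR-0 P4, S4b — the centre identity (CC₀) FROM THE CENTRAL TYPE `−𝟙_{w(ι₁)}` of the twisted slot, and the knob that makes the slot-`0`
# character equal to a given `V`-character (inputs of ★ `Theorems/H413ThetaDistAtLineArchTypes`)

Cell hodgecm-mathlib (D-0151), FLOOR 0, crux item H413 = stmt-HodgeConjecture-24833; programme P4, line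
`Cruxes/H413/Lines/F0_P4AdmissibleOccursInH1.lean` (ED. 2.1), stub S4b `stub_T3a_holThetaAtAdmissibleLineOfRallisAt` (lead F0P4-p01).  Author F0P4-p04
(g2).  `--supports stmt-HodgeConjecture-24833 --as helper`.  KERNEL ONLY: theorems over LANDED model-layer theorems; no `sorry`, no definition.

WHY.  ★ `Theorems/H413ThetaDistAtLineArchTypes` derives the archimedean inputs `harm` ∕ `hdef` of ★ `ThetaDistAtLine.distDatumAt` at a general weight-one
`μ` from carch's centre identity (CC₀) `Ξ((t · 1_V)^𝔸) · lineC V a hGR₀ t = 1` for the slot-`0` character `Ξ := lineCharV_zero … (etaT₀ η ν)`.  This file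
supplies the two remaining kernel links to the junction with [Liu2021]'s `μ`-splitting:

* §1 **`CC_of_centralTypeOfTwist_eq`** — the CONVERSE of ★ `LiuIndex.centralTypeOfTwist_bigCharOfV_of_CC`: if the record of record twisted by
  `ĉ = bigCharOfV c_V` has central type `centralTypeOfTwist … = −𝟙_{w(ι₁)}`, then (CC₀) holds for `Ξ := c_V` (types add: ★ `centralTypeOfTwist_bigCharOfV`,
  `charArchType_eq_iff`; (F1)'s `lineC = lineCenterChar · ι_{w(ι₁)}`); and **`CC_of_hasCentralTypeAt_twistBy`** — the same from
  `HasCentralTypeAt V a ((ofCMOf … hGR₀).twistBy ĉ hĉ).s (−𝟙_{w(ι₁)})` (★ `hasCentralTypeAt_twistBy_ofCMOf_iff_eq`), the currency in which the COR-CM cell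
  proves the central type of the `μ`-splitting (★ `CorCM/B01/Transposition/Item6CentralTypeAtPin`
  `hasCentralTypeAt_chiSplittingLine_toHeckeCharacter`: type `∓𝟙_{mk ι₁}`, sign = admissibility at `ι₁`).
* §2 **the knob** `(η, ν) := (c_V ∘ pr₁, χ₀(·, 1))` of ★ `ThetaDistAtLine.sideAt` for a `V`-character `c_V`: `lineCharV_zero … (etaT₀ η ν) = c_V` ON THE NOSE
  (`lineCharV_zero_etaT₀_knob`: the see-saw discrepancy `χ₀ = cmLineChar₀` CANCELS), with the side's four conditions: `hν` (★ `cmLineChar₀_inl_eq_one_of_rat`),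
  `hνc` (★ `continuous_cmLineChar₀_of_signs`), `hη` ∕ `hηc` from the rational triviality ∕ continuity of `c_V` (`knob_hν`, `knob_hνc`, `knob_hη`, `knob_hηc`).
  For `c_V :=` the `V`-part of the GLOBAL central twist `s_μ = s₀ · ĉ` (★ `exists_eq_twist_of_isCompatible`) all four slot-`0` scalars of the model then
  read `ĉ_V` (finite part = the line-transport character `λ` of F0P4-p01's knob equation, by `rfl`), and (CC₀) is the central type of `s_μ`.
* §3 (ED. 2) **`CC_of_hasCentralTypeAt_of_center_smul`** — (CC₀) for `κ` DIRECTLY from `HasCentralTypeAt V a s (−𝟙_{w(ι₁)})` of ANY pair splitting `s` whose centre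
  action on the Gaussian test functions is `κ`-times that of the splitting of record (no twisted record needed; the S4b assembler's shape).
* §4 (ED. 3) **`CC_of_hasCentralTypeAt_twist`** — the same for a splitting `adelicMpCont.twist … (splittingOf … hGR) ĉ` (the letter of ★
  `Theorems/H413OmegaAtLineAdelicTwist` (i)), `κ := ĉ ∘ adelicInl`: (CC₀) from `HasCentralTypeAt V a (s₀ ⊗ ĉ) (−𝟙_{w(ι₁)})` ALONE (★ `UnitaryDualPair.pairRep_twist_apply`).

HC_CM is proved only modulo the printed citations until rung 0 closes.

## References
* Tree (all ★): `HodgeCM/Model/LiuIndexTwistTypeOfV` (`centerCharInf`, `centralTypeOfTwist_bigCharOfV`, `archWeight_single_zpow`), `HodgeCM/Model/LiuIndexTwistType`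
  (`hasCentralTypeAt_twistBy_ofCMOf_iff_eq`), `HodgeCM/Model/LiuIndexCentralType_2` (`centralTypeOf_eq_charArchType_kappaOf`), `HodgeCM/Model/ArchLineDatumOf_2`
  (`lineC_def`), `HodgeCM/Model/ArchKTypeOfCentralWeight_1` (`lineCharV_zero_apply`), `HodgeCM/Model/ArchSideOfTwist` (`etaT₀_apply_mk_one`, `continuous_etaT₀`),
  `HodgeCM/Model/AdelicThetaDistributionBridgeTwist` (`ThetaAdelicSide.cmLineChar₀_inl_eq_one_of_rat`), `HodgeCM/Model/ArchLineSlotTypeCont` (`continuous_cmLineChar₀_of_signs`).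
* [Liu2021] Y. Liu, Camb. J. Math. 9 (2021), App. D §D.1 Steps 1–3, Lem. D.2; [GelbartRogawski1991] §3.1 Prop. 3.1.1, Remark p. 457 L4–13.
-/

set_option autoImplicit false
set_option linter.dupNamespace false

noncomputable section

open NumberField hiding relNormOneIdeles relNormOneRat probHaarRelNormOneQuot
open _root_.NumberField.InfinitePlace _root_.NumberField.mixedEmbedding MeasureTheory MulAction IsDedekindDomain
open scoped Matrix TensorProduct Classical SchwartzMap
open Literature.NumberTheory.Automorphic Literature.NumberTheory.Automorphic.UnitaryGroup Literature.NumberTheory.Weil1964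
open Literature.NumberTheory.GelbartRogawski1991 Literature.NumberTheory.GelbartRogawski1991.UnitaryDualPair
open Literature.RepresentationTheory.KonnoKonno2007 Literature.RepresentationTheory.KonnoKonno2007.RealDualPair
open Literature.Analysis.SegalBargmann
open HodgeCM HodgeCM.Adelic HodgeCM.PerL34 HodgeCM.Model HodgeCM.Model.HypCensus HodgeCM.Model.ArchSideTerm HodgeCM.Model.LiuIndex

namespace Summit.HodgeConjecture.HodgeConjecture.Cruxes.H413.ThetaDistAtLine

/-! ## §1 (CC₀) from the central type of the twisted slot -/

section CentralType

variable {L : CMField} {ι₁ : L →+* ℂ} (V : HermSpace3 L ι₁) (a : RealScalar L)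
  (hGR : (cmSplittingDatum (L : Type) e₁ (frameD V) (frameD_real V) (frameD_ne V) (RealScalar.vec a) (RealScalar.vec_real a)
    (RealScalar.vec_ne a)).CompatibleSplitting)
  (hJW : (Matrix.diagonal (RealScalar.vec a)) default default ≠ 0)
  (cV : ↥(UnitaryGroup.adelic (↥(maximalRealSubfield (L : Type))) (L : Type) (IsCMField.complexConj (L : Type)) 3 (Matrix.diagonal (frameD V))) →* ℂˣ)
  (hcV : Continuous fun v => ((cV v : ℂˣ) : ℂ))

include hcV in
/-- **(CC₀) FROM THE TWISTED CENTRAL TYPE `−𝟙_{w(ι₁)}`** (converse of ★ `LiuIndex.centralTypeOfTwist_bigCharOfV_of_CC`): if the record of record at the line `a`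
twisted by `ĉ = bigCharOfV c_V` has `centralTypeOfTwist = −𝟙_{w(ι₁)}`, then `c_V(u_t · 1_V) · lineC V a hGR t = 1` for every `t ∈ U(1)(L⁺ ⊗ ℝ)`.
[cite: Liu2021, App. D Lem. D.2] [cite: KonnoKonno2007, Lemma 5.2] -/
theorem CC_of_centralTypeOfTwist_eq
    (h : Continuous (twistInf V a (HodgeCM.LinePair.bigCharOfV (↥(maximalRealSubfield (L : Type))) (L : Type) (IsCMField.complexConj (L : Type)) 3
      (Matrix.diagonal (frameD V)) (Matrix.diagonal (RealScalar.vec a)) hJW cV)))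
    (hct : centralTypeOfTwist V a hGR
        (HodgeCM.LinePair.bigCharOfV (↥(maximalRealSubfield (L : Type))) (L : Type) (IsCMField.complexConj (L : Type)) 3
          (Matrix.diagonal (frameD V)) (Matrix.diagonal (RealScalar.vec a)) hJW cV) h =
      -(Pi.single (cmPlaceOver (L : Type) (HypCensus.cmPlace (L : Type) ι₁)).1 1))
    (t : ↥(Literature.NumberTheory.Automorphic.relNormOneInfUnits (↥(maximalRealSubfield L)) L)) :
    ((cV (CMCenter (L : Type) (frameD V) (infUnitToOne (L : Type) t)) : ℂˣ) : ℂ) * HodgeCM.Model.ArchSideTerm.lineC V a.1 a.2.1 a.2.2 hGR t = 1 := by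
  rw [centralTypeOfTwist_bigCharOfV V a hGR hJW cV hcV, ← eq_sub_iff_add_eq, Literature.NumberTheory.Automorphic.charArchType_eq_iff] at hct
  have hl : Literature.NumberTheory.Automorphic.archWeight (L : Type) (centralTypeOf V a hGR) t =
      ((lineCenterChar V a.1 a.2.1 a.2.2 hGR t : Circle) : ℂ) := by
    rw [centralTypeOf_eq_charArchType_kappaOf, Literature.NumberTheory.Automorphic.archWeight_charArchType]
    rfl
  have hp : Literature.NumberTheory.Automorphic.archWeight (L : Type) (Pi.single (cmPlaceOver (L : Type) (HypCensus.cmPlace (L : Type) ι₁)).1 1) t =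
      ((NumberField.archPlaceChar (L : Type) (cmPlaceOver (L : Type) (HypCensus.cmPlace (L : Type) ι₁)).1 t : Circle) : ℂ) := by
    rw [archWeight_single_zpow, zpow_one]
    rfl
  have hc : ((cV (CMCenter (L : Type) (frameD V) (infUnitToOne (L : Type) t)) : ℂˣ) : ℂ) =
      Literature.NumberTheory.Automorphic.archWeight (L : Type)
        (-(Pi.single (cmPlaceOver (L : Type) (HypCensus.cmPlace (L : Type) ι₁)).1 1) - centralTypeOf V a hGR) t := by
    rw [← centerCharInf_apply, hct]
  rw [HodgeCM.Model.ArchSideTerm.lineC_def, hc, sub_eq_add_neg, Literature.NumberTheory.Automorphic.archWeight_add,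
    Literature.NumberTheory.Automorphic.archWeight_neg, Literature.NumberTheory.Automorphic.archWeight_neg, hp, hl]
  have h1 : ((lineCenterChar V a.1 a.2.1 a.2.2 hGR t : Circle) : ℂ) ≠ 0 := Circle.coe_ne_zero _
  have h2 : ((NumberField.archPlaceChar (L : Type) (cmPlaceOver (L : Type) (HypCensus.cmPlace (L : Type) ι₁)).1 t : Circle) : ℂ) ≠ 0 := Circle.coe_ne_zero _
  field_simp

include hcV in
/-- **(CC₀) FROM `HasCentralTypeAt … (−𝟙_{w(ι₁)})` of the twisted record** — the currency of ★ `LiuIndex.hasCentralTypeAt_twistBy_ofCMOf_iff_eq` and of the COR-CM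
central-type theorems for the `μ`-splitting (★ `CorCM/B01/Transposition/Item6CentralTypeAtPin`). [cite: Liu2021, App. D Lem. D.2] -/
theorem CC_of_hasCentralTypeAt_twistBy
    (hĉ : (SplitLineE.ofCMOf V e₁ (RealScalar.vec a) (RealScalar.vec_real a) (RealScalar.vec_ne a) hGR).IsRatTrivial
      (HodgeCM.LinePair.bigCharOfV (↥(maximalRealSubfield (L : Type))) (L : Type) (IsCMField.complexConj (L : Type)) 3
        (Matrix.diagonal (frameD V)) (Matrix.diagonal (RealScalar.vec a)) hJW cV))
    (hct : HasCentralTypeAt V a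
        ((SplitLineE.ofCMOf V e₁ (RealScalar.vec a) (RealScalar.vec_real a) (RealScalar.vec_ne a) hGR).twistBy
          (HodgeCM.LinePair.bigCharOfV (↥(maximalRealSubfield (L : Type))) (L : Type) (IsCMField.complexConj (L : Type)) 3
            (Matrix.diagonal (frameD V)) (Matrix.diagonal (RealScalar.vec a)) hJW cV) hĉ).s
        (-(Pi.single (cmPlaceOver (L : Type) (HypCensus.cmPlace (L : Type) ι₁)).1 1)))
    (t : ↥(Literature.NumberTheory.Automorphic.relNormOneInfUnits (↥(maximalRealSubfield L)) L)) :
    ((cV (CMCenter (L : Type) (frameD V) (infUnitToOne (L : Type) t)) : ℂˣ) : ℂ) * HodgeCM.Model.ArchSideTerm.lineC V a.1 a.2.1 a.2.2 hGR t = 1 :=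
  CC_of_centralTypeOfTwist_eq V a hGR hJW cV hcV (continuous_twistInf_bigCharOfV V a hJW cV hcV)
    (((hasCentralTypeAt_twistBy_ofCMOf_iff_eq V a hGR _ hĉ (continuous_twistInf_bigCharOfV V a hJW cV hcV) _).mp hct).symm) t

end CentralType

/-! ## §2 The knob of `sideAt` that makes the slot-`0` character a given `V`-character -/

section Knob

variable {L : CMField} {ι₁ : L →+* ℂ} (V : HermSpace3 L ι₁) (c : SeesawCtx L)
variable
  (hGR : (cmSplittingDatum (L : Type) finProdFinEquiv (frameD V) (frameD_real V) (frameD_ne V) (dW c.D) (dW_real c.D) (dW_ne c.D)).CompatibleSplitting)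
  (hGR₀ : (cmSplittingDatum (L : Type) (e₁) (frameD V) (frameD_real V) (frameD_ne V) (lineVec (L : Type) (dW c.D 0))
    (fun _ => dW_real c.D 0) (fun _ => dW_ne c.D 0)).CompatibleSplitting)
  (hGR₁ : (cmSplittingDatum (L : Type) (e₁) (frameD V) (frameD_real V) (frameD_ne V) (lineVec (L : Type) (dW c.D 1))
    (fun _ => dW_real c.D 1) (fun _ => dW_ne c.D 1)).CompatibleSplitting)
  (h₁W : (∀ j, 0 < (ι₁ (dW c.D j)).re) ∨ ∀ j, (ι₁ (dW c.D j)).re < 0)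
  (cV : CMAdelic (L : Type) (frameD V) →* ℂˣ) (hcV : Continuous fun v => ((cV v : ℂˣ) : ℂ))
  (hcVrat : ∀ γU ∈ CMRat (L : Type) (frameD V), cV γU = 1)

/-- **THE KNOB**: for `η := c_V ∘ pr₁` and `ν := χ₀(·, 1)` (the see-saw discrepancy of slot `0` read on `U(V)`), the slot-`0` character of the twisted split is
`c_V` on the nose: `lineCharV_zero … (etaT₀ η ν) = c_V` (`χ₀` cancels). [cite: GelbartRogawski1991, §3.1 Remark p. 457 L4–13] -/
theorem lineCharV_zero_etaT₀_knob :
    lineCharV_zero V c.D hGR hGR₀ hGR₁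
        (etaT₀ V c.D (cV.comp (MonoidHom.fst _ _))
          ((cmLineChar₀ (L : Type) finProdFinEquiv e₁ (frameD V) (frameD_real V) (frameD_ne V) (dW c.D) (dW_real c.D) (dW_ne c.D) hGR hGR₀ hGR₁).comp
            (MonoidHom.inl _ _))) = cV := by
  ext v
  rw [lineCharV_zero_apply, etaT₀_apply_mk_one]
  change ((((cmLineChar₀ (L : Type) finProdFinEquiv e₁ (frameD V) (frameD_real V) (frameD_ne V) (dW c.D) (dW_real c.D) (dW_ne c.D) hGR hGR₀ hGR₁)
      (v, 1))⁻¹ * cV v *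
    (cmLineChar₀ (L : Type) finProdFinEquiv e₁ (frameD V) (frameD_real V) (frameD_ne V) (dW c.D) (dW_real c.D) (dW_ne c.D) hGR hGR₀ hGR₁) (v, 1) : ℂˣ) : ℂ) = _
  rw [mul_comm _ (cV v), inv_mul_cancel_right]

/-- the knob's `hη`: `η := c_V ∘ pr₁` is trivial on rational pairs when `c_V` is trivial on `U(V)(L⁺)`. [folklore] -/
theorem knob_hη (hcVrat : ∀ γU ∈ CMRat (L : Type) (frameD V), cV γU = 1) :
    ∀ γU ∈ CMRat (L : Type) (frameD V), ∀ γ ∈ CMRat (L : Type) (dW c.D),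
      (cV.comp (MonoidHom.fst (CMAdelic (L : Type) (frameD V)) (CMAdelic (L : Type) (dW c.D)))) (γU, γ) = 1 :=
  fun γU hγU _ _ => hcVrat γU hγU

include hcV in
/-- the knob's `hηc`: `η := c_V ∘ pr₁` is continuous when `c_V` is. [folklore] -/
theorem knob_hηc : Continuous fun p => (((cV.comp (MonoidHom.fst (CMAdelic (L : Type) (frameD V)) (CMAdelic (L : Type) (dW c.D)))) p : ℂˣ) : ℂ) :=
  hcV.comp continuous_fst

/-- the knob's `hν`: `ν := χ₀(·, 1)` is trivial on `U(V)(L⁺)` (★ `cmLineChar₀_inl_eq_one_of_rat`). [cite: Weil1964, n° 41 Thm 6] -/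
theorem knob_hν : ∀ γU ∈ CMRat (L : Type) (frameD V),
    ((cmLineChar₀ (L : Type) finProdFinEquiv e₁ (frameD V) (frameD_real V) (frameD_ne V) (dW c.D) (dW_real c.D) (dW_ne c.D) hGR hGR₀ hGR₁).comp
      (MonoidHom.inl _ _)) γU = 1 :=
  fun _ hγU => ThetaAdelicSide.cmLineChar₀_inl_eq_one_of_rat V c hGR hGR₀ hGR₁ hγU

include h₁W in
/-- the knob's `hνc`: `ν := χ₀(·, 1)` is continuous (★ `continuous_cmLineChar₀_of_signs`, sign facts of `V` and of the plane at `ι₁`). [folklore] -/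
theorem knob_hνc : Continuous fun v =>
    ((((cmLineChar₀ (L : Type) finProdFinEquiv e₁ (frameD V) (frameD_real V) (frameD_ne V) (dW c.D) (dW_real c.D) (dW_ne c.D) hGR hGR₀ hGR₁).comp
      (MonoidHom.inl _ _)) v : ℂˣ) : ℂ) :=
  (continuous_cmLineChar₀_of_signs (L : Type) finProdFinEquiv e₁ (frameD V) (frameD_real V) (frameD_ne V) (dW c.D) (dW_real c.D) (dW_ne c.D)
    hGR hGR₀ hGR₁ ι₁ (frameD_sign_ι₁' V) h₁W (frameD_sign_of_ne V)).comp (continuous_id.prodMk continuous_const)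

end Knob

/-! ## §3 (ED. 2) (CC₀) DIRECTLY from a central-type equation of ANY splitting that is `s₀ ⊗ κ` at the centre

For the S4b assembler (F0P4-p01's SEAT-i MEMO v4 §5, knob `(η, ν) = (1, χ₀(·,1) · κ⁻¹)`, `κ := ĉ ∘ ι_V` the `V`-part of the adelic twist of ★
`Theorems/H413OmegaAtLineAdelicTwist`, so that the slot-`0` character is `κ`): no twisted record is needed — (CC₀) for `κ` follows from the central type
`−𝟙_{w(ι₁)}` of ANY pair splitting `s` at the scalar `a` (e.g. Liu's `μ`-splitting, ★ `CorCM/B01/Transposition/Item6CentralTypeAtPin`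
`hasCentralTypeAt_chiSplittingLine_toHeckeCharacter` under `(mk ι₁).embedding ∈ Φ_μ`) whose centre action on the Gaussian test functions is `κ`-times that
of the splitting of record `s₀ = splittingOf hGR₀` (the twist equation `s = s₀ ⊗ ĉ` at the central elements `(u_t · 1_V, 1)`). -/

section Direct

open HodgeCM.Model.SupplyInstance (testFun)

variable {L : CMField} {ι₁ : L →+* ℂ} (V : HermSpace3 L ι₁) (a : RealScalar L)
  (hGR : (cmSplittingDatum (L : Type) e₁ (frameD V) (frameD_real V) (frameD_ne V) (RealScalar.vec a) (RealScalar.vec_real a)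
    (RealScalar.vec_ne a)).CompatibleSplitting)
  (κ : CMAdelic (L : Type) (frameD V) →* ℂˣ) (s : SplittingAt V a)

/-- **(CC₀) FROM `HasCentralTypeAt V a s (−𝟙_{w(ι₁)})` AND THE TWIST AT THE CENTRE.**  If a pair splitting `s` at the scalar `a` has central type `−𝟙_{w(ι₁)}`
and acts on the Gaussian test functions at the central elements `(u_t · 1_V, 1)` as `κ(u_t · 1_V)` times the splitting of record (★ `pairRep_splittingOf_center_testFun_gaussianAt`:
the latter acts by (F1)'s `lineCenterChar`), then `κ(u_t · 1_V) · lineC V a hGR t = 1` — the hypothesis `hCC` of ★ `Theorems/H413ThetaDistAtLineArchTypes` for `Ξ := κ`.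
[cite: Liu2021, App. D §D.1 Steps 1–3, Lem. D.2] [cite: GelbartRogawski1991, §3.1 Prop. 3.1.1, Remark p. 457 L4–13] -/
theorem CC_of_hasCentralTypeAt_of_center_smul
    (hct : HasCentralTypeAt V a s (-(Pi.single (cmPlaceOver (L : Type) (HypCensus.cmPlace (L : Type) ι₁)).1 1)))
    (htw : ∀ (t : ↥(Literature.NumberTheory.Automorphic.relNormOneInfUnits (↥(maximalRealSubfield L)) L))
        (x₀ : Fin 3 → ↥(maximalRealSubfield L)) (Nl : ℕ),
      pairRep (↥(maximalRealSubfield L)) L (IsCMField.complexConj L) 3 1 e₁ (Matrix.diagonal (frameD V)) (Matrix.diagonal (RealScalar.vec a)) s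
          (CMCenter (L : Type) (frameD V)
            ((cmAdelicOneEquivRelNormOne (L : Type)).symm
              (Literature.NumberTheory.Automorphic.relNormOneInfToIdeles (↥(maximalRealSubfield L)) L t)), 1)
          (testFun (↥(maximalRealSubfield L)) (Fin 3) (gaussianAt V a) x₀ Nl) =
        ((κ (CMCenter (L : Type) (frameD V)
            ((cmAdelicOneEquivRelNormOne (L : Type)).symm
              (Literature.NumberTheory.Automorphic.relNormOneInfToIdeles (↥(maximalRealSubfield L)) L t))) : ℂˣ) : ℂ) •
          pairRep (↥(maximalRealSubfield L)) L (IsCMField.complexConj L) 3 1 e₁ (Matrix.diagonal (frameD V)) (Matrix.diagonal (RealScalar.vec a))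
            (splittingOf (↥(maximalRealSubfield (L : Type))) (L : Type) (IsCMField.complexConj (L : Type)) 3 1 e₁
              (Matrix.diagonal (frameD V)) (Matrix.diagonal (RealScalar.vec a)) (complexConj_imagUnit (L : Type)) (imagUnit_ne_zero (L : Type))
              (imagUnit_mul_self (L : Type)) (realDiagonal_isSymm (L : Type) (frameD V) (frameD_real V))
              (realDiagonal_isSymm (L : Type) (RealScalar.vec a) (RealScalar.vec_real a))
              (isUnit_det_realDiagonal (L : Type) (frameD V) (frameD_real V) (frameD_ne V))
              (isUnit_det_realDiagonal (L : Type) (RealScalar.vec a) (RealScalar.vec_real a) (RealScalar.vec_ne a))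
              (realDiagonal_map (L : Type) (frameD V) (frameD_real V)).symm
              (realDiagonal_map (L : Type) (RealScalar.vec a) (RealScalar.vec_real a)).symm hGR)
            (CMCenter (L : Type) (frameD V)
              ((cmAdelicOneEquivRelNormOne (L : Type)).symm
                (Literature.NumberTheory.Automorphic.relNormOneInfToIdeles (↥(maximalRealSubfield L)) L t)), 1)
            (testFun (↥(maximalRealSubfield L)) (Fin 3) (gaussianAt V a) x₀ Nl))
    (t : ↥(Literature.NumberTheory.Automorphic.relNormOneInfUnits (↥(maximalRealSubfield L)) L)) :
    ((κ (CMCenter (L : Type) (frameD V) (infUnitToOne (L : Type) t)) : ℂˣ) : ℂ) * HodgeCM.Model.ArchSideTerm.lineC V a.1 a.2.1 a.2.2 hGR t = 1 := by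
  obtain ⟨x₀, hx₀⟩ := exists_testFun_gaussianAt_ne_zero V a
  have h1 := hct t x₀ 1
  rw [htw t x₀ 1, pairRep_splittingOf_center_testFun_gaussianAt V a hGR t x₀ 1, smul_smul] at h1
  have h2 := smul_left_injective ℂ hx₀ h1
  have hp : Literature.NumberTheory.Automorphic.archWeight (L : Type) (-(Pi.single (cmPlaceOver (L : Type) (HypCensus.cmPlace (L : Type) ι₁)).1 1)) t =
      (((NumberField.archPlaceChar (L : Type) (cmPlaceOver (L : Type) (HypCensus.cmPlace (L : Type) ι₁)).1 t : Circle) : ℂ))⁻¹ := by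
    rw [Literature.NumberTheory.Automorphic.archWeight_neg, archWeight_single_zpow, zpow_one]
    rfl
  rw [infUnitToOne_apply, HodgeCM.Model.ArchSideTerm.lineC_def, ← mul_assoc]
  rw [hp] at h2
  rw [h2]
  exact inv_mul_cancel₀ (Circle.coe_ne_zero _)

end Direct

/-! ## §4 (ED. 3) (CC₀) from the central type of a TWISTED splitting `s₀ ⊗ ĉ` — the letter of ★ `Theorems/H413OmegaAtLineAdelicTwist`

F0P4-p01's junction (★ p797879 `exists_coinv_equiv_TW_splittingOf_adelic` (i)) delivers Liu's `μ`-splitting at the line AS `adelicMpCont.twist … (splittingOf … h) ĉ`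
for an adelic pair character `ĉ` (rationally trivial, continuous).  For such a twisted splitting the centre hypothesis `htw` of §3 is ★ `UnitaryDualPair.pairRep_twist_apply`,
so (CC₀) for `κ := ĉ ∘ adelicInl` follows from the central type alone (★ `UnitaryDualPair.pairRep_twist_apply`, `pairMap_apply`). -/

section Twist

open HodgeCM.Model.SupplyInstance (testFun)

variable {L : CMField} {ι₁ : L →+* ℂ} (V : HermSpace3 L ι₁) (a : RealScalar L)
  (hGR : (cmSplittingDatum (L : Type) e₁ (frameD V) (frameD_real V) (frameD_ne V) (RealScalar.vec a) (RealScalar.vec_real a)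
    (RealScalar.vec_ne a)).CompatibleSplitting)
  (ĉ : UnitaryGroup.adelicPair (↥(maximalRealSubfield (L : Type))) (L : Type) (IsCMField.complexConj (L : Type)) 3 1 (Matrix.diagonal (frameD V))
    (Matrix.diagonal (RealScalar.vec a)) →* ℂˣ)

/-- **(CC₀) FROM THE CENTRAL TYPE OF `s₀ ⊗ ĉ`.**  If the splitting of record twisted by the adelic pair character `ĉ` — the shape in which ★
`Theorems/H413OmegaAtLineAdelicTwist` delivers Liu's `μ`-splitting — has central type `−𝟙_{w(ι₁)}` at the scalar `a` (★
`CorCM/B01/Transposition/Item6CentralTypeAtPin.hasCentralTypeAt_chiSplittingLine_toHeckeCharacter`, branch `(mk ι₁).embedding ∈ Φ_μ`), then the `V`-part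
`κ := ĉ ∘ adelicInl` satisfies carch's centre identity `κ(u_t · 1_V) · lineC V a hGR t = 1` — the hypothesis `hCC` of ★ `Theorems/H413ThetaDistAtLineArchTypes` at
F0P4-p01's knob `(η, ν) = (1, χ₀(·,1) · κ⁻¹)`. [cite: Liu2021, App. D §D.1 Steps 1–3, Lem. D.2] [cite: GelbartRogawski1991, §3.1 Prop. 3.1.1, Remark p. 457 L4–13] -/
theorem CC_of_hasCentralTypeAt_twist
    (hct : HasCentralTypeAt V a
      (adelicMpCont.twist (↥(maximalRealSubfield (L : Type))) (Fin 3) _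
        (splittingOf (↥(maximalRealSubfield (L : Type))) (L : Type) (IsCMField.complexConj (L : Type)) 3 1 e₁
          (Matrix.diagonal (frameD V)) (Matrix.diagonal (RealScalar.vec a)) (complexConj_imagUnit (L : Type)) (imagUnit_ne_zero (L : Type))
          (imagUnit_mul_self (L : Type)) (realDiagonal_isSymm (L : Type) (frameD V) (frameD_real V))
          (realDiagonal_isSymm (L : Type) (RealScalar.vec a) (RealScalar.vec_real a))
          (isUnit_det_realDiagonal (L : Type) (frameD V) (frameD_real V) (frameD_ne V))
          (isUnit_det_realDiagonal (L : Type) (RealScalar.vec a) (RealScalar.vec_real a) (RealScalar.vec_ne a))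
          (realDiagonal_map (L : Type) (frameD V) (frameD_real V)).symm
          (realDiagonal_map (L : Type) (RealScalar.vec a) (RealScalar.vec_real a)).symm hGR) ĉ)
      (-(Pi.single (cmPlaceOver (L : Type) (HypCensus.cmPlace (L : Type) ι₁)).1 1)))
    (t : ↥(Literature.NumberTheory.Automorphic.relNormOneInfUnits (↥(maximalRealSubfield L)) L)) :
    ((ĉ (UnitaryGroup.adelicInl (↥(maximalRealSubfield (L : Type))) (L : Type) (IsCMField.complexConj (L : Type)) 3 1 (Matrix.diagonal (frameD V))
          (Matrix.diagonal (RealScalar.vec a)) (CMCenter (L : Type) (frameD V) (infUnitToOne (L : Type) t))) : ℂˣ) : ℂ) *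
      HodgeCM.Model.ArchSideTerm.lineC V a.1 a.2.1 a.2.2 hGR t = 1 :=
  CC_of_hasCentralTypeAt_of_center_smul V a hGR
    (ĉ.comp (UnitaryGroup.adelicInl (↥(maximalRealSubfield (L : Type))) (L : Type) (IsCMField.complexConj (L : Type)) 3 1 (Matrix.diagonal (frameD V))
      (Matrix.diagonal (RealScalar.vec a)))) _ hct
    (fun t x₀ Nl => by
      rw [Literature.NumberTheory.GelbartRogawski1991.UnitaryDualPair.pairRep_twist_apply,
        Literature.NumberTheory.GelbartRogawski1991.UnitaryDualPair.pairMap_apply, map_one, mul_one, MonoidHom.comp_apply]) t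

end Twist

end Summit.HodgeConjecture.HodgeConjecture.Cruxes.H413.ThetaDistAtLine

end
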